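import Summits.Ventures.HodgeRepro2.T5InertSatakeCounts

/-!
# The Satake transform of `T₁` at an inert place: `q²(X + X⁻¹) + (q − 1)` as printed
(cell pub-hodge-repro2, seat p3)

Tier-5 N3 support — T5-SATAKE-KERNEL-p3.md row 12, the one sentence of the Satake chain still in print:
«the Satake transform sends `T₁` to `q²(X + X⁻¹) + (q − 1)`». The transform of a bi-`K`-invariant `f` is
`S f (t) = δ_B(t)^{1/2} ∫_N f(t n) dn` (`vol N(R) = 1`); for `f = T₁ = 1_{K a₁ K}` and `t = a_m` the integral is
file 212's `satakeCount 1 m` and the modulus character is the index of `a_m N(R) a_m⁻¹` in `N(R)`. This file: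

* `relIndex_unipCong_succ_succ` / **`relIndex_unipCong_cell`** — `[N_{m,2m} : N_{m+1,2m+2}] = Q q²` and
  `[N(R) : N_{m,2m}] = (Q q²)^m`;
* **`relIndex_map_conj_cellU_unipCong`** — `δ_B(a_m)⁻¹ = [N(R) : a_m N(R) a_m⁻¹] = (Q q²)^m = q^{4m}` (`m ≥ 0`),
  so `δ_B(a_m)^{1/2} = q^{−2m}` (`deltaHalf_sq_mul_relIndex`);
* **`satakeTransformOne m`** `:= q^{−2m} · satakeCount 1 m` and its values **`q²`, `q − 1`, `q²`** at
  `m = 1, 0, −1` and `0` elsewhere (`satakeTransformOne_eq`): `S(T₁) = q² X + (q − 1) + q² X⁻¹`.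

Hypotheses: p8's standing ones for the local package, the trace lift `htr` and the non-triviality `hnt` of the
residue involution (the inert-place features, files 202 / 204 / 206). What stays print after this file: the
Macdonald–Satake identification of the Hecke eigenvalue of the spherical vector of an unramified principal series
with `S(T₁)` evaluated at its Satake parameter (the definition of the parameter through induction).

Mathlib + this seat's file 212 and its imports; no display; no device.
§8(d): uses an L-value-free non-vanishing device: NO.
-/

namespace Summit.Ventures.HodgeRepro2.T5InertSatakeTransform

open Summit.Ventures.HodgeRepro2.T5CartanCellsDistinct Summit.Ventures.HodgeRepro2.T5HeckeBasisCells
  Summit.Ventures.HodgeRepro2.T5HermitianThreeElements Summit.Ventures.HodgeRepro2.T5UnitaryGroupForm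
  Summit.Ventures.HodgeRepro2.T5UnitaryHeckeAdjoint Summit.Ventures.HodgeRepro2.T5InertUnipotentCongruence
  Summit.Ventures.HodgeRepro2.T5InertUnipotentResidue Summit.Ventures.HodgeRepro2.T5InertResidueInvolution
  Summit.Ventures.HodgeRepro2.T5InertDegreeCount Summit.Ventures.HodgeRepro2.T5InertUnipotentRadical
  Summit.Ventures.HodgeRepro2.T5InertSatakeSets Summit.Ventures.HodgeRepro2.T5InertSatakeCounts

/-! ## The modulus character: `[N(R) : a_m N(R) a_m⁻¹]` -/

section Modulus

variable {R E : Type*} [CommRing R] [IsDomain R] [IsDiscreteValuationRing R] [Field E] [StarRing E]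
  [Algebra R E] [IsFractionRing R E]
  (hstar : ∀ x : E, IsLocalization.IsInteger R x → IsLocalization.IsInteger R (star x))
  (u : E) (hsu : star u = u) (hu0 : u ≠ 0) (hu' : IsLocalization.IsInteger R u⁻¹) {ϖ : R}
  (hϖ : Irreducible ϖ) (hs : star (algebraMap R E ϖ) = algebraMap R E ϖ)

omit [IsDomain R] [IsDiscreteValuationRing R] [IsFractionRing R E] in
/-- `N_{a,b}` depends only on the indices. -/
theorem unipCong_congr {a b a' b' : ℕ} {hab : b ≤ 2 * a} {hab' : b' ≤ 2 * a'} (ha : a = a') (hb : b = b') :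
    unipCong hstar u hu' hs a b hab = unipCong hstar u hu' hs a' b' hab' := by
  subst ha; subst hb; rfl

include hsu hu0 hϖ in
/-- **`[N_{m,2m} : N_{m+1,2m+2}] = Q q²`** for every `m ≥ 0`. -/
theorem relIndex_unipCong_succ_succ (htr : ∃ e : R, algebraMap R E e + star (algebraMap R E e) = 1) (m : ℕ) :
    (unipCong hstar u hu' hs (m + 1) (2 * (m + 1)) le_rfl).relIndex (unipCong hstar u hu' hs m (2 * m) le_rfl) =
      Nat.card (IsLocalRing.ResidueField R) * Nat.card (traceZero R E) ^ 2 := by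
  have h1 : unipCong hstar u hu' hs (m + 1) (2 * m + 1 + 1) (by omega) ≤
      unipCong hstar u hu' hs (m + 1) (2 * m + 1) (by omega) :=
    unipCong_mono hstar u hu' hs le_rfl (Nat.le_succ _)
  have h2 : unipCong hstar u hu' hs (m + 1) (2 * m + 1) (by omega) ≤
      unipCong hstar u hu' hs (m + 1) (2 * m) (by omega) :=
    unipCong_mono hstar u hu' hs le_rfl (Nat.le_succ _)
  have h3 : unipCong hstar u hu' hs (m + 1) (2 * m) (by omega) ≤
      unipCong hstar u hu' hs m (2 * m) le_rfl :=
    unipCong_mono hstar u hu' hs (Nat.le_succ m) le_rfl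
  rw [unipCong_congr hstar u hu' hs (a' := m + 1) (b' := 2 * m + 1 + 1) (hab' := by omega) rfl (by ring),
    ← Subgroup.relIndex_mul_relIndex _ _ _ h1 (h2.trans h3), ← Subgroup.relIndex_mul_relIndex _ _ _ h2 h3,
    relIndex_unipCong_succ_right hstar u hsu hu0 hu' hϖ hs (a := m + 1) (b := 2 * m + 1) (hab := by omega) htr
      (by omega),
    relIndex_unipCong_succ_right hstar u hsu hu0 hu' hϖ hs (a := m + 1) (b := 2 * m) (hab := by omega) htr
      (by omega),
    relIndex_unipCong_succ_left hstar u hsu hu0 hu' hϖ hs (a := m) (b := 2 * m) (hab := le_rfl) htr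
      (by omega)]
  ring

include hsu hu0 hϖ in
/-- **`[N(R) : N_{m,2m}] = (Q q²)^m`.** -/
theorem relIndex_unipCong_cell (htr : ∃ e : R, algebraMap R E e + star (algebraMap R E e) = 1) (m : ℕ) :
    (unipCong hstar u hu' hs m (2 * m) le_rfl).relIndex (unipCong hstar u hu' hs 0 0 le_rfl) =
      (Nat.card (IsLocalRing.ResidueField R) * Nat.card (traceZero R E) ^ 2) ^ m := by
  induction m with
  | zero =>
    rw [unipCong_congr hstar u hu' hs (a' := 0) (b' := 0) (hab' := le_rfl) rfl (by ring), Subgroup.relIndex_self,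
      pow_zero]
  | succ m ih =>
    have hle : unipCong hstar u hu' hs (m + 1) (2 * (m + 1)) le_rfl ≤ unipCong hstar u hu' hs m (2 * m) le_rfl :=
      unipCong_mono hstar u hu' hs (Nat.le_succ m) (by omega)
    have hle' : unipCong hstar u hu' hs m (2 * m) le_rfl ≤ unipCong hstar u hu' hs 0 0 le_rfl :=
      unipCong_mono hstar u hu' hs (Nat.zero_le m) (Nat.zero_le _)
    rw [← Subgroup.relIndex_mul_relIndex _ _ _ hle hle', relIndex_unipCong_succ_succ hstar u hsu hu0 hu' hϖ hs htr m,
      ih]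
    ring

include hsu hu0 in
/-- **The modulus character**: `δ_B(a_m)⁻¹ = [N(R) : a_m N(R) a_m⁻¹] = (Q q²)^m` for `m ≥ 0`. -/
theorem relIndex_map_conj_cellU_unipCong (htr : ∃ e : R, algebraMap R E e + star (algebraMap R E e) = 1)
    (m : ℕ) :
    ((unipCong hstar u hu' hs 0 0 le_rfl).map (MulAut.conj (cellU hϖ hs u m)).toMonoidHom).relIndex
        (unipCong hstar u hu' hs 0 0 le_rfl) =
      (Nat.card (IsLocalRing.ResidueField R) * Nat.card (traceZero R E) ^ 2) ^ m := by
  rw [map_conj_cellU_unipCong hstar u hu' hϖ hs m 0 0 le_rfl (by omega),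
    unipCong_congr hstar u hu' hs (a' := m) (b' := 2 * m) (hab' := le_rfl) (by ring) (by ring),
    relIndex_unipCong_cell hstar u hsu hu0 hu' hϖ hs htr m]

include hsu hu0 in
/-- **`δ_B(a_m)⁻¹ = q^{4m}`** when the residue involution is non-trivial (`Q = q²`). -/
theorem relIndex_map_conj_cellU_unipCong_eq_pow (htr : ∃ e : R, algebraMap R E e + star (algebraMap R E e) = 1)
    (hnt : ∃ t : IsLocalRing.ResidueField R, residueStar hstar hϖ hs t ≠ t) (m : ℕ) :
    ((unipCong hstar u hu' hs 0 0 le_rfl).map (MulAut.conj (cellU hϖ hs u m)).toMonoidHom).relIndex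
        (unipCong hstar u hu' hs 0 0 le_rfl) = Nat.card (traceZero R E) ^ (4 * m) := by
  rw [relIndex_map_conj_cellU_unipCong hstar u hsu hu0 hu' hϖ hs htr m, card_residueField_eq_sq hstar hϖ hs htr hnt,
    ← pow_add, ← pow_mul]

variable [Finite (IsLocalRing.ResidueField R)]

include hsu hu0 in
/-- `δ_B(a_m)^{1/2} = q^{−2m}`: the square of `q^{−2m}` times the modulus index is `1`. -/
theorem deltaHalf_sq_mul_relIndex (htr : ∃ e : R, algebraMap R E e + star (algebraMap R E e) = 1)
    (hnt : ∃ t : IsLocalRing.ResidueField R, residueStar hstar hϖ hs t ≠ t) (m : ℕ) :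
    ((Nat.card (traceZero R E) : ℚ) ^ (-2 * (m : ℤ))) ^ 2 *
      (((unipCong hstar u hu' hs 0 0 le_rfl).map (MulAut.conj (cellU hϖ hs u m)).toMonoidHom).relIndex
        (unipCong hstar u hu' hs 0 0 le_rfl) : ℚ) = 1 := by
  rw [relIndex_map_conj_cellU_unipCong_eq_pow hstar u hsu hu0 hu' hϖ hs htr hnt m]
  have hq : (Nat.card (traceZero R E) : ℚ) ≠ 0 := by
    haveI : Nonempty (traceZero R E) := ⟨⟨0, 0, map_zero _, by rw [map_zero, star_zero, add_zero]⟩⟩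
    exact_mod_cast Nat.card_pos.ne'
  rw [Nat.cast_pow, ← _root_.zpow_natCast (Nat.card (traceZero R E) : ℚ) (4 * m), ← _root_.zpow_natCast _ 2,
    ← _root_.zpow_mul, ← zpow_add₀ hq]
  have : (-2 * (m : ℤ)) * ((2 : ℕ) : ℤ) + ((4 * m : ℕ) : ℤ) = 0 := by push_cast; ring
  rw [this, zpow_zero]

end Modulus

/-! ## The value table of `S(T₁)`: `q² X + (q − 1) + q² X⁻¹` -/

section Transform

variable {R E : Type*} [CommRing R] [IsDomain R] [IsDiscreteValuationRing R] [Field E] [StarRing E]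
  [Algebra R E] [IsFractionRing R E] [Finite (IsLocalRing.ResidueField R)]
  (hstar : ∀ x : E, IsLocalization.IsInteger R x → IsLocalization.IsInteger R (star x))
  (u : E) (hsu : star u = u) (hu0 : u ≠ 0) (hu : IsLocalization.IsInteger R u)
  (hu' : IsLocalization.IsInteger R u⁻¹) {ϖ : R} (hϖ : Irreducible ϖ)
  (hs : star (algebraMap R E ϖ) = algebraMap R E ϖ)

omit [IsFractionRing R E] in
/-- `q = #{t ∈ 𝔽 : t + t̄ = 0} ≥ 1` (`0` is trace-zero). -/
theorem card_traceZero_pos : 0 < Nat.card (traceZero R E) := by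
  haveI : Nonempty (traceZero R E) := ⟨⟨0, 0, map_zero _, by rw [map_zero, star_zero, add_zero]⟩⟩
  exact Nat.card_pos

/-- **The Satake transform of `T₁` at the cell `a_m`**: `δ_B(a_m)^{1/2} · ∫_N 1_{K a₁ K}(a_m n) dn`, with
`δ_B(a_m)^{1/2} = q^{−2m}` (`relIndex_map_conj_cellU_unipCong_eq_pow`, `deltaHalf_sq_mul_relIndex`) and the
integral `satakeCount 1 m` of file 212 (`vol N(R) = 1`). -/
noncomputable def satakeTransformOne (m : ℤ) : ℚ :=
  (Nat.card (traceZero R E) : ℚ) ^ (-2 * m) * (satakeCount hstar u hu' hϖ hs 1 m : ℚ)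

include hsu hu0 hu in
/-- **`S(T₁)(a₁) = q²`** (`q^{−2} · q⁴`). -/
theorem satakeTransformOne_one (htr : ∃ e : R, algebraMap R E e + star (algebraMap R E e) = 1)
    (hnt : ∃ t : IsLocalRing.ResidueField R, residueStar hstar hϖ hs t ≠ t) :
    satakeTransformOne hstar u hu' hϖ hs 1 = (Nat.card (traceZero R E) : ℚ) ^ 2 := by
  have hq : (Nat.card (traceZero R E) : ℚ) ≠ 0 := by exact_mod_cast (card_traceZero_pos (R := R) (E := E)).ne'
  rw [satakeTransformOne, satakeCount_one_one_eq_pow_four hstar u hsu hu0 hu hu' hϖ hs htr hnt, Nat.cast_pow,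
    ← _root_.zpow_natCast (Nat.card (traceZero R E) : ℚ) 4, ← zpow_add₀ hq]
  have h2 : (-2 * (1 : ℤ) + ((4 : ℕ) : ℤ)) = ((2 : ℕ) : ℤ) := by norm_num
  rw [h2, _root_.zpow_natCast]

include hsu hu0 hu in
/-- **`S(T₁)(1) = q − 1`.** -/
theorem satakeTransformOne_zero (htr : ∃ e : R, algebraMap R E e + star (algebraMap R E e) = 1) :
    satakeTransformOne hstar u hu' hϖ hs 0 = (Nat.card (traceZero R E) : ℚ) - 1 := by
  rw [satakeTransformOne, satakeCount_one_zero hstar u hsu hu0 hu hu' hϖ hs htr, Nat.cast_sub card_traceZero_pos,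
    Nat.cast_one, mul_zero, zpow_zero, one_mul]

include hsu hu0 hu in
/-- **`S(T₁)(a₁⁻¹) = q²`** (`q² · 1`). -/
theorem satakeTransformOne_neg_one :
    satakeTransformOne hstar u hu' hϖ hs (-1) = (Nat.card (traceZero R E) : ℚ) ^ 2 := by
  rw [satakeTransformOne, satakeCount_one_neg_one hstar u hsu hu0 hu hu' hϖ hs, Nat.cast_one, mul_one]
  have h2 : (-2 * (-1 : ℤ)) = ((2 : ℕ) : ℤ) := by norm_num
  rw [h2, _root_.zpow_natCast]

include hsu hu0 hu in
/-- `S(T₁)(a_m) = 0` for `m ≥ 2`. -/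
theorem satakeTransformOne_of_two_le {m : ℤ} (hm : 2 ≤ m) : satakeTransformOne hstar u hu' hϖ hs m = 0 := by
  rw [satakeTransformOne, satakeCount_one_of_two_le hstar u hsu hu0 hu hu' hϖ hs hm, Nat.cast_zero, mul_zero]

include hsu hu0 hu in
/-- `S(T₁)(a_m) = 0` for `m ≤ −2`. -/
theorem satakeTransformOne_of_le_neg_two {m : ℤ} (hm : m ≤ -2) :
    satakeTransformOne hstar u hu' hϖ hs m = 0 := by
  rw [satakeTransformOne, satakeCount_one_of_le_neg_two hstar u hsu hu0 hu hu' hϖ hs hm, Nat.cast_zero, mul_zero]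

include hsu hu0 hu in
/-- **ROW 12 AS PRINTED: `S(T₁) = q² X + (q − 1) + q² X⁻¹`** — the coefficient of `X^m` in the Satake transform
of `T₁` is `q²` at `m = ±1`, `q − 1` at `m = 0` and `0` elsewhere. -/
theorem satakeTransformOne_eq (htr : ∃ e : R, algebraMap R E e + star (algebraMap R E e) = 1)
    (hnt : ∃ t : IsLocalRing.ResidueField R, residueStar hstar hϖ hs t ≠ t) (m : ℤ) :
    satakeTransformOne hstar u hu' hϖ hs m =
      (Nat.card (traceZero R E) : ℚ) ^ 2 * (if m = 1 then 1 else 0) +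
        ((Nat.card (traceZero R E) : ℚ) - 1) * (if m = 0 then 1 else 0) +
        (Nat.card (traceZero R E) : ℚ) ^ 2 * (if m = -1 then 1 else 0) := by
  by_cases h1 : m = 1
  · subst h1
    rw [satakeTransformOne_one hstar u hsu hu0 hu hu' hϖ hs htr hnt, if_pos rfl, if_neg (by norm_num),
      if_neg (by norm_num)]
    ring
  by_cases h0 : m = 0
  · subst h0
    rw [satakeTransformOne_zero hstar u hsu hu0 hu hu' hϖ hs htr, if_neg (by norm_num), if_pos rfl,
      if_neg (by norm_num)]
    ring
  by_cases hm1 : m = -1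
  · subst hm1
    rw [satakeTransformOne_neg_one hstar u hsu hu0 hu hu' hϖ hs, if_neg (by norm_num), if_neg (by norm_num),
      if_pos rfl]
    ring
  rw [if_neg h1, if_neg h0, if_neg hm1]
  rcases (show 2 ≤ m ∨ m ≤ -2 by omega) with h | h
  · rw [satakeTransformOne_of_two_le hstar u hsu hu0 hu hu' hϖ hs h]
    ring
  · rw [satakeTransformOne_of_le_neg_two hstar u hsu hu0 hu hu' hϖ hs h]
    ring

end Transform

end Summit.Ventures.HodgeRepro2.T5InertSatakeTransform
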